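import Summits.CriticalPhenomena.CardyFormulaZ2.Theorems.CardyBoundaryCoulombGasRectilinearCardyDefs
import Summits.CriticalPhenomena.CardyFormulaZ2.Theorems.CardyBoundaryCoulombGasRectilinearCardyStubFiniteCorners
import Summits.CriticalPhenomena.CardyFormulaZ2.Theorems.RectilinearCardy.Negative.RectilinearCardyReductions
import Literature.Probability.RandomPlanarGeometry.ConformalRectangleProofs
import Literature.Probability.RandomPlanarGeometry.CardyFunctionIncBeta
import HarnessLib

/-!
# Stub `stub_flatMarksReduction` of line `excursion-kernel-covariance`
# (crux `RectilinearCardy`, stmt-CriticalPhenomena-5660, route `CardyBoundaryCoulombGas`)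

The flat-marks reduction: Cardy's formula for all rectilinear conformal rectangles whose four
marked points are FLAT boundary points implies Cardy's formula for all rectilinear conformal
rectangles `R = (Ω; a, b, c, d)`.

Proof. Let `(φ, g, S₀, S)` be the boundary correspondence of `R` (first hypothesis: `φ : ℍₒ → Ω`
has boundary value `∂Ω(t)` at the real point `g t` for `t ∈ [S₀, S] ⊋ [0, mark 3]`, `g` continuous
and strictly monotone-or-antitone there). Then `x i = g (mark i)` is a uniformizing datum of `R`, so
by datum-independence of the cross-ratio it suffices to show `P_δ(R) → F(η(x))`.
* Non-flat parameters of `[S₀, S]` are finite (`exists_finset_flatNear`: they are sent by the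
  boundary loop, injective on `[S₀, S] ⊆ [S₀, S₀ + 1)`, into the finite grid of crossings of the
  covering axis-parallel segments; `exists_flat_near_of_not_mem_grid` of the landed `FiniteCorners`).
* For flat parameters `m₀ < m₁ < m₂ < m₃` in `[S₀, S₀ + 1)` the re-parametrised, re-marked rectangle
  `R♯ = (Ω; ∂Ω(m₀), …, ∂Ω(m₃))` (boundary loop `u ↦ ∂Ω(u + S₀)`, marks `mᵢ - S₀ ∈ [0, 1)`, SAME
  carrier) is rectilinear with flat marks, `(φ, (g mᵢ)ᵢ)` is a uniformizing datum of it, and its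
  crossing probability is `P_δ[∂Ω[m₀, m₁] ↔ ∂Ω[m₂, m₃]]`; so the second hypothesis gives
  `P_δ[∂Ω[m₀, m₁] ↔ ∂Ω[m₂, m₃]] → F(η((g mᵢ)ᵢ))` (`tendsto_crossingProb_of_flatParams`).
* The crossing event is monotone in both arcs (`discreteArc_mono` of the `Defs` module, hence
  `discreteCrossingProb_mono`): shrinking both arcs of `R` to flat end-parameters gives a lower
  bound, enlarging them an upper bound, for every mesh `δ`.
* `m ↦ F(η((g mᵢ)ᵢ))` is continuous at `m = mark` within `[S₀, S]⁴` (continuity of `g`, of the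
  cross-ratio off its poles, of `F` on `[0, 1]`), so flat end-parameters within `κ` of the marks
  squeeze `P_δ(R)` into `(F(η(x)) - ε, F(η(x)) + ε)` for all small `δ`.
-/

noncomputable section

open Set Filter Topology MeasureTheory
open Literature.Probability.RandomPlanarGeometry
open Literature.Probability.Percolation (bondDomainCrossingProb discreteCrossingProb half)
open Literature.Probability.LatticeModels (discreteArc)
open Summit.CriticalPhenomena.CardyFormulaZ2.Theorems.RectilinearCardy.Negative (IsRectilinear)
open UpperHalfPlane (upperHalfPlaneSet)

namespace Summit.CriticalPhenomena.CardyFormulaZ2.Cruxes.RectilinearCardy.ExcursionKernelCovariance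

/-! ### Finiteness of the non-flat parameters on a sub-period -/

/-- **Flat parameters are co-finite on any sub-period.** For a rectilinear conformal rectangle and a
parameter interval `[S₀, S]` with `S < S₀ + 1` (so that the boundary loop is injective on it), all
but finitely many `s ∈ [S₀, S]` are flat: the frontier near `R.boundary s` lies on the horizontal, or
on the vertical, line through it. (The landed `stub_finiteCorners` is the case `[mark 1, mark 3]`.)
[folklore] -/
theorem exists_finset_flatNear (R : ConformalRectangle) (hR : IsRectilinear R) {S₀ S : ℝ}
    (hS : S < S₀ + 1) :
    ∃ T : Finset ℝ, ∀ s ∈ Icc S₀ S, s ∉ T → ∃ r : ℝ, 0 < r ∧ FlatNear R (R.boundary s) r := by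
  classical
  obtain ⟨S', hS', hsub⟩ := hR
  set G : Finset ℂ := (S' ×ˢ S').image fun pq : (ℂ × ℂ) × (ℂ × ℂ) => (⟨pq.2.1.re, pq.1.1.im⟩ : ℂ)
    with hG
  -- the boundary loop is injective on `[S₀, S] ⊆ [S₀, S₀ + 1)`
  have hinj : InjOn R.boundary (Icc S₀ S) :=
    (R.toJordanDomain.injOn_boundary_Ico S₀).mono (Icc_subset_Ico_right hS)
  -- so only finitely many parameters of `[S₀, S]` are sent into the grid `G`
  have hfin : (Icc S₀ S ∩ R.boundary ⁻¹' (↑G : Set ℂ)).Finite :=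
    Set.Finite.of_finite_image (G.finite_toSet.subset (image_subset_iff.2 fun s hs => hs.2))
      (hinj.mono inter_subset_left)
  refine ⟨hfin.toFinset, fun s hs hsT => ?_⟩
  have hz : R.boundary s ∉ G := fun h => hsT (hfin.mem_toFinset.2 ⟨hs, h⟩)
  exact exists_flat_near_of_not_mem_grid hS' hsub hz

/-- Four parameters, one in each of four non-degenerate open intervals, avoiding a finite set. [folklore] -/
theorem exists_quadruple_notMem (T : Finset ℝ) {a b : Fin 4 → ℝ} (hab : ∀ i, a i < b i) :
    ∃ u : Fin 4 → ℝ, ∀ i, u i ∈ Ioo (a i) (b i) ∧ u i ∉ T := by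
  choose u hu huT using fun i => (Ioo_infinite (hab i)).exists_notMem_finset T
  exact ⟨u, fun i => ⟨hu i, huT i⟩⟩

/-! ### Monotonicity of the crossing probability in the two arcs -/

/-- **The crossing probability is monotone in both arcs**: enlarging the arcs `A ⊆ A'`, `B ⊆ B'`
(nonempty, and the larger ones not exhausting the frontier) enlarges both discrete arcs
(`discreteArc_mono`), hence the crossing event, hence its probability. [folklore] -/
theorem discreteCrossingProb_mono {Ω : Set ℂ} {δ : ℝ} {A A' B B' : Set ℂ} (hA : A ⊆ A')
    (hAn : A.Nonempty) (hA' : (frontier Ω \ A').Nonempty) (hB : B ⊆ B') (hBn : B.Nonempty)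
    (hB' : (frontier Ω \ B').Nonempty) :
    discreteCrossingProb half Ω δ A B ≤ discreteCrossingProb half Ω δ A' B' := by
  unfold Literature.Probability.Percolation.discreteCrossingProb
  refine measureReal_mono ?_ (measure_ne_top _ _)
  rintro ω ⟨x, hx, y, hy, hxy⟩
  exact ⟨x, discreteArc_mono hA hAn hA' hx, y, discreteArc_mono hB hBn hB' hy, hxy⟩

/-- A boundary point whose parameter lies in the sub-period `[S₀, S]` (`S < S₀ + 1`) but outside
`[a, b] ⊆ [S₀, S]` is not on the sub-arc `boundary '' [a, b]` (injectivity of the loop on a period).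
[folklore] -/
theorem boundary_notMem_image_Icc (R : ConformalRectangle) {S₀ S a b t : ℝ} (hS : S < S₀ + 1)
    (ha : S₀ ≤ a) (hb : b ≤ S) (ht : t ∈ Icc S₀ S) (htab : t ∉ Icc a b) :
    R.boundary t ∉ R.boundary '' Icc a b := by
  rintro ⟨s, hs, hst⟩
  have h := R.toJordanDomain.injOn_boundary_Ico S₀ ⟨ha.trans hs.1, (hs.2.trans hb).trans_lt hS⟩
    ⟨ht.1, ht.2.trans_lt hS⟩ hst
  exact htab (h ▸ hs)

/-! ### Cardy's formula for the re-marked rectangle with flat marks -/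

/-- Composing a strictly monotone-or-antitone real function with strictly increasing parameters
inside its interval gives a strictly monotone or strictly antitone tuple. [folklore] -/
theorem strictMono_or_strictAnti_comp {g : ℝ → ℝ} {s : Set ℝ}
    (hgm : StrictMonoOn g s ∨ StrictAntiOn g s) {m : Fin 4 → ℝ} (hm : StrictMono m)
    (hms : ∀ i, m i ∈ s) : StrictMono (fun i => g (m i)) ∨ StrictAnti (fun i => g (m i)) :=
  hgm.imp (fun h _ _ hab => h (hms _) (hms _) (hm hab)) (fun h _ _ hab => h (hms _) (hms _) (hm hab))

/-- **Cardy's formula for the re-marked rectangle.** Assume Cardy's formula for all rectilinear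
conformal rectangles with flat marks. Let `R` be rectilinear, `m₀ < m₁ < m₂ < m₃` parameters in a
period `[S₀, S₀ + 1)` at which the boundary is flat, and `(φ, x)` a conformal equivalence `ℍₒ → Ω`
with boundary value `∂Ω(mᵢ)` at the (monotone or antitone) real points `xᵢ`. Then the probability of
an open crossing of `Ω_δ` between the discretised arcs `∂Ω[m₀, m₁]` and `∂Ω[m₂, m₃]` tends to
`F(η(x))`: it is the crossing probability of the RE-MARKED rectangle `R♯ = (Ω; ∂Ω(m₀), …, ∂Ω(m₃))`
(same carrier, boundary loop re-based at `S₀`, marks `mᵢ - S₀ ∈ [0, 1)`), which is rectilinear with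
flat marks and has `(φ, x)` as a uniformizing datum. [folklore] -/
theorem tendsto_crossingProb_of_flatParams
    (hflat : ∀ R : ConformalRectangle, IsRectilinear R →
      (∀ i : Fin 4, ∃ r : ℝ, 0 < r ∧ FlatNear R (R.pt i) r) →
        R.HasCrossingLimit (bondDomainCrossingProb R) cardyFunction)
    (R : ConformalRectangle) (hR : IsRectilinear R) {S₀ : ℝ} {m : Fin 4 → ℝ} (hm : StrictMono m)
    (h0 : S₀ ≤ m 0) (h3 : m 3 < S₀ + 1) (hmf : ∀ i, ∃ r : ℝ, 0 < r ∧ FlatNear R (R.boundary (m i)) r)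
    (φ : ConformalEquiv upperHalfPlaneSet R.carrier) {x : Fin 4 → ℝ} (hx : StrictMono x ∨ StrictAnti x)
    (hbv : ∀ i, φ.HasBoundaryValue (x i) (R.boundary (m i))) :
    Tendsto (fun δ => discreteCrossingProb half R.carrier δ (R.boundary '' Icc (m 0) (m 1))
      (R.boundary '' Icc (m 2) (m 3))) (𝓝[>] 0) (𝓝 (cardyFunction (crossRatio x))) := by
  have hle3 : ∀ i : Fin 4, i ≤ 3 := by decide
  -- the re-parametrised, re-marked rectangle `R♯` (same carrier)
  let R' : ConformalRectangle :=
    { carrier := R.carrier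
      boundary := fun u => R.boundary (u + S₀)
      isOpen := R.isOpen
      isBounded := R.isBounded
      isConnected := R.isConnected
      continuous_boundary := R.continuous_boundary.comp (continuous_id.add continuous_const)
      periodic_boundary := R.periodic_boundary.add_const _
      injOn_boundary := fun s hs t ht hst => add_right_cancel (R.toJordanDomain.injOn_boundary_Ico S₀
        (show s + S₀ ∈ Ico S₀ (S₀ + 1) from ⟨by linarith [hs.1], by linarith [hs.2]⟩)
        (show t + S₀ ∈ Ico S₀ (S₀ + 1) from ⟨by linarith [ht.1], by linarith [ht.2]⟩) hst)
      range_boundary := by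
        rw [show (fun u => R.boundary (u + S₀)) = R.boundary ∘ fun u => u + S₀ from rfl,
          (add_right_surjective _).range_comp]
        exact R.range_boundary
      mark := fun i => m i - S₀
      strictMono_mark := fun i j hij => sub_lt_sub_right (hm hij) _
      mark_mem := fun i => ⟨sub_nonneg.2 (h0.trans (hm.monotone (Fin.zero_le i))),
        by linarith [hm.monotone (hle3 i)]⟩ }
  -- its marked points, arcs and crossing probabilities, read on `R`
  have hpt : ∀ i, R'.pt i = R.boundary (m i) := fun i => by
    show R.boundary (m i - S₀ + S₀) = R.boundary (m i)
    rw [sub_add_cancel]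
  have him : ∀ a b : ℝ, R'.boundary '' Icc (a - S₀) (b - S₀) = R.boundary '' Icc a b := fun a b => by
    show (fun u => R.boundary (u + S₀)) '' Icc (a - S₀) (b - S₀) = _
    rw [show (fun u => R.boundary (u + S₀)) = R.boundary ∘ fun u => u + S₀ from rfl, image_comp,
      image_add_const_Icc, sub_add_cancel, sub_add_cancel]
  have h0' : R'.arc 0 = R.boundary '' Icc (m 0) (m 1) := by
    show R'.boundary '' Icc (R'.mark 0) (R'.nextMark 0) = _
    rw [R'.nextMark_zero]
    exact him _ _
  have h2' : R'.arc 2 = R.boundary '' Icc (m 2) (m 3) := by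
    show R'.boundary '' Icc (R'.mark 2) (R'.nextMark 2) = _
    rw [R'.nextMark_two]
    exact him _ _
  have heq : bondDomainCrossingProb R' = fun δ => discreteCrossingProb half R.carrier δ
      (R.boundary '' Icc (m 0) (m 1)) (R.boundary '' Icc (m 2) (m 3)) := by
    funext δ
    show discreteCrossingProb half R.carrier δ (R'.arc 0) (R'.arc 2) = _
    rw [h0', h2']
  -- `R♯` is rectilinear with flat marks, and `(φ, x)` is a uniformizing datum of it
  have hR' : IsRectilinear R' := hR
  have hflat' : ∀ i : Fin 4, ∃ r : ℝ, 0 < r ∧ FlatNear R' (R'.pt i) r := fun i => by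
    obtain ⟨r, hr, hf⟩ := hmf i
    exact ⟨r, hr, by rw [hpt]; exact hf⟩
  have hU' : R'.IsUniformizing φ x := ⟨hx, fun i => by rw [hpt]; exact hbv i⟩
  have hlim := hflat R' hR' hflat' φ x hU'
  rwa [heq] at hlim

/-! ### Continuity of the predicted limit in the marks -/

/-- **The predicted limit depends continuously on the four parameters.** If `g` is continuous on
`[S₀, S]` and `(g (m₀ i))ᵢ` is strictly monotone or antitone (so its cross-ratio lies in `(0, 1)`,
off the poles), then `m ↦ F(η((g (m i))ᵢ))` is continuous at `m₀` within `[S₀, S]⁴`: composition of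
`g`, of the cross-ratio (a rational function with non-vanishing denominator) and of Cardy's function
(continuous on `[0, 1]`, `continuousOn_cardyFunction_holds`). Metric form. [folklore] -/
theorem exists_forall_dist_cardyFunction_lt {g : ℝ → ℝ} {S₀ S : ℝ} (hgc : ContinuousOn g (Icc S₀ S))
    {m₀ : Fin 4 → ℝ} (hm₀ : ∀ i, m₀ i ∈ Icc S₀ S)
    (hx : StrictMono (fun i => g (m₀ i)) ∨ StrictAnti (fun i => g (m₀ i))) {ε : ℝ} (hε : 0 < ε) :
    ∃ η : ℝ, 0 < η ∧ ∀ m : Fin 4 → ℝ, (∀ i, m i ∈ Icc S₀ S) → (∀ i, dist (m i) (m₀ i) < η) →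
      dist (cardyFunction (crossRatio fun i => g (m i)))
        (cardyFunction (crossRatio fun i => g (m₀ i))) < ε := by
  -- continuity of `m ↦ (g (m i))ᵢ` within `[S₀, S]⁴` at `m₀`
  have h1 : ContinuousWithinAt (fun m : Fin 4 → ℝ => fun i => g (m i))
      (Set.pi univ fun _ => Icc S₀ S) m₀ := by
    refine continuousWithinAt_pi.2 fun i => ?_
    exact (hgc _ (hm₀ i)).comp (f := fun m : Fin 4 → ℝ => m i) (x := m₀)
      (continuous_apply i).continuousWithinAt fun m hm => hm i (mem_univ i)
  -- continuity of the cross-ratio at `(g (m₀ i))ᵢ` (non-vanishing denominator)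
  have h02 : g (m₀ 0) ≠ g (m₀ 2) := hx.elim (fun h => (h (show (0 : Fin 4) < 2 by decide)).ne)
    (fun h => (h (show (0 : Fin 4) < 2 by decide)).ne')
  have h13 : g (m₀ 1) ≠ g (m₀ 3) := hx.elim (fun h => (h (show (1 : Fin 4) < 3 by decide)).ne)
    (fun h => (h (show (1 : Fin 4) < 3 by decide)).ne')
  have h2 : ContinuousAt crossRatio (fun i => g (m₀ i)) := by
    have hden : (g (m₀ 0) - g (m₀ 2)) * (g (m₀ 1) - g (m₀ 3)) ≠ 0 :=
      mul_ne_zero (sub_ne_zero.2 h02) (sub_ne_zero.2 h13)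
    show ContinuousAt (fun y : Fin 4 → ℝ => (y 0 - y 1) * (y 2 - y 3) / ((y 0 - y 2) * (y 1 - y 3)))
      (fun i => g (m₀ i))
    exact ContinuousAt.div (by fun_prop) (by fun_prop) hden
  -- continuity of Cardy's function at the cross-ratio, a point of `(0, 1)`
  have hcr := crossRatio_mem_Ioo hx
  have hcF : ContinuousOn cardyFunction (Icc 0 1) := continuousOn_cardyFunction_holds
  have h3 : ContinuousAt cardyFunction (crossRatio fun i => g (m₀ i)) :=
    hcF.continuousAt (Icc_mem_nhds hcr.1 hcr.2)
  have h4 : ContinuousWithinAt ((cardyFunction ∘ crossRatio) ∘ fun m : Fin 4 → ℝ => fun i => g (m i))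
      (Set.pi univ fun _ => Icc S₀ S) m₀ :=
    (h3.comp h2).comp_continuousWithinAt h1
  obtain ⟨η, hη, hcont⟩ := Metric.continuousWithinAt_iff.1 h4 ε hε
  exact ⟨η, hη, fun m hm hd => hcont (fun i _ => hm i) ((dist_pi_lt_iff hη).2 hd)⟩

/-! ### The stub -/

/-- **Stub 4 of the line (`FlatMarksReduction`, inlined over tree vocabulary).** Cardy's formula for
all rectilinear conformal rectangles with FLAT marked points (second hypothesis) implies Cardy's
formula for all rectilinear conformal rectangles, given the boundary correspondence of every
conformal rectangle (first hypothesis, the landed `stub_boundaryCorrespondence`). Proof: the datum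
`x = g ∘ mark` computes the modulus (`crossRatio_eq_of_isUniformizing_holds`); non-flat parameters
are finite (`exists_finset_flatNear`); moving each mark to a nearby flat parameter inwards (resp.
outwards) shrinks (resp. enlarges) both arcs, which decreases (resp. increases) the crossing
probability at every mesh (`discreteCrossingProb_mono`); the perturbed rectangles are re-marked
copies of `R` with flat marks, whose crossing probabilities converge to `F(η(g ∘ m))` by hypothesis
(`tendsto_crossingProb_of_flatParams`); and `F(η(g ∘ m)) → F(η(x))` as `m → mark`
(`exists_forall_dist_cardyFunction_lt`), whence the squeeze. [folklore] -/
theorem stub_flatMarksReduction :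
    (∀ R : ConformalRectangle,
        ∃ (φ : ConformalEquiv upperHalfPlaneSet R.carrier) (g : ℝ → ℝ) (S₀ S : ℝ) (w₀ : ℂ → ℂ),
          S₀ < 0 ∧ R.mark 3 < S ∧ S < 1 ∧ S < S₀ + 1 ∧
          ContinuousOn g (Icc S₀ S) ∧ (StrictMonoOn g (Icc S₀ S) ∨ StrictAntiOn g (Icc S₀ S)) ∧
          (∀ t ∈ Icc S₀ S, φ.HasBoundaryValue (g t) (R.boundary t)) ∧
          EqOn w₀ φ.symm R.carrier ∧ ContinuousOn w₀ (R.carrier ∪ R.boundary '' Icc S₀ S) ∧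
          ∀ t ∈ Icc S₀ S, w₀ (R.boundary t) = g t) →
      (∀ R : ConformalRectangle, IsRectilinear R → (∀ i : Fin 4, ∃ r : ℝ, 0 < r ∧ FlatNear R (R.pt i) r) →
        R.HasCrossingLimit (bondDomainCrossingProb R) cardyFunction) →
      ∀ R : ConformalRectangle, IsRectilinear R →
        R.HasCrossingLimit (bondDomainCrossingProb R) cardyFunction := by
  intro hBC hflat R hR φ' x' hU'
  obtain ⟨φ, g, S₀, S, w₀, hS₀, h3S, -, hSS₀, hgc, hgm, hbv, -, -, -⟩ := hBC R
  -- bookkeeping on the marks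
  have hle3 : ∀ i : Fin 4, i ≤ 3 := by decide
  have h01 : R.mark 0 < R.mark 1 := R.strictMono_mark (by decide)
  have h12 : R.mark 1 < R.mark 2 := R.strictMono_mark (by decide)
  have h23 : R.mark 2 < R.mark 3 := R.strictMono_mark (by decide)
  have hm0 : 0 ≤ R.mark 0 := (R.mark_mem 0).1
  have hmI : ∀ i, R.mark i ∈ Icc S₀ S := fun i =>
    ⟨hS₀.le.trans (R.mark_mem i).1, (R.strictMono_mark.monotone (hle3 i)).trans h3S.le⟩
  have harc0 : R.arc 0 = R.boundary '' Icc (R.mark 0) (R.mark 1) := by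
    show R.boundary '' Icc (R.mark 0) (R.nextMark 0) = _
    rw [R.nextMark_zero]
  have harc2 : R.arc 2 = R.boundary '' Icc (R.mark 2) (R.mark 3) := by
    show R.boundary '' Icc (R.mark 2) (R.nextMark 2) = _
    rw [R.nextMark_two]
  -- (1) the datum `x = g ∘ mark` computes the modulus
  have hx : StrictMono (fun i => g (R.mark i)) ∨ StrictAnti (fun i => g (R.mark i)) :=
    strictMono_or_strictAnti_comp hgm R.strictMono_mark hmI
  have hU : R.IsUniformizing φ (fun i => g (R.mark i)) := ⟨hx, fun i => hbv _ (hmI i)⟩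
  rw [ConformalRectangle.crossRatio_eq_of_isUniformizing_holds hU' hU]
  -- (2) flat parameters are co-finite on `[S₀, S]`
  obtain ⟨T, hT⟩ := exists_finset_flatNear R hR hSS₀
  rw [Metric.tendsto_nhds]
  intro ε hε
  -- (6a) continuity of the predicted limit in the marks: the size `η`, and a common size `c`
  obtain ⟨η, hη, hcont⟩ := exists_forall_dist_cardyFunction_lt hgc hmI hx (half_pos hε)
  set c : ℝ := min η (min (R.mark 0 - S₀) (min (S - R.mark 3) (min ((R.mark 1 - R.mark 0) / 2)
    (min ((R.mark 2 - R.mark 1) / 2) ((R.mark 3 - R.mark 2) / 2))))) with hc_def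
  have hc : 0 < c := lt_min hη (lt_min (by linarith) (lt_min (by linarith) (lt_min (by linarith)
    (lt_min (by linarith) (by linarith)))))
  have hcη : c ≤ η := min_le_left _ _
  have hcA : c ≤ min (R.mark 0 - S₀) (min (S - R.mark 3) (min ((R.mark 1 - R.mark 0) / 2)
      (min ((R.mark 2 - R.mark 1) / 2) ((R.mark 3 - R.mark 2) / 2)))) := min_le_right _ _
  have hc0 : c ≤ R.mark 0 - S₀ := hcA.trans (min_le_left _ _)
  have hcB := hcA.trans (min_le_right _ _)
  have hc3 : c ≤ S - R.mark 3 := hcB.trans (min_le_left _ _)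
  have hcC := hcB.trans (min_le_right _ _)
  have hc01 : c ≤ (R.mark 1 - R.mark 0) / 2 := hcC.trans (min_le_left _ _)
  have hcD := hcC.trans (min_le_right _ _)
  have hc12 : c ≤ (R.mark 2 - R.mark 1) / 2 := hcD.trans (min_le_left _ _)
  have hc23 : c ≤ (R.mark 3 - R.mark 2) / 2 := hcD.trans (min_le_right _ _)
  -- (2') flat parameters within `c` of the marks: `u` inwards (arcs shrunk), `v` outwards (enlarged)
  obtain ⟨u, hu⟩ := exists_quadruple_notMem T
    (a := ![R.mark 0, R.mark 1 - c, R.mark 2, R.mark 3 - c])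
    (b := ![R.mark 0 + c, R.mark 1, R.mark 2 + c, R.mark 3]) fun i => by
      fin_cases i
      · show R.mark 0 < R.mark 0 + c; linarith
      · show R.mark 1 - c < R.mark 1; linarith
      · show R.mark 2 < R.mark 2 + c; linarith
      · show R.mark 3 - c < R.mark 3; linarith
  obtain ⟨v, hv⟩ := exists_quadruple_notMem T
    (a := ![R.mark 0 - c, R.mark 1, R.mark 2 - c, R.mark 3])
    (b := ![R.mark 0, R.mark 1 + c, R.mark 2, R.mark 3 + c]) fun i => by
      fin_cases i
      · show R.mark 0 - c < R.mark 0; linarith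
      · show R.mark 1 < R.mark 1 + c; linarith
      · show R.mark 2 - c < R.mark 2; linarith
      · show R.mark 3 < R.mark 3 + c; linarith
  have hu0 : R.mark 0 < u 0 ∧ u 0 < R.mark 0 + c := (hu 0).1
  have hu1 : R.mark 1 - c < u 1 ∧ u 1 < R.mark 1 := (hu 1).1
  have hu2 : R.mark 2 < u 2 ∧ u 2 < R.mark 2 + c := (hu 2).1
  have hu3 : R.mark 3 - c < u 3 ∧ u 3 < R.mark 3 := (hu 3).1
  have hv0 : R.mark 0 - c < v 0 ∧ v 0 < R.mark 0 := (hv 0).1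
  have hv1 : R.mark 1 < v 1 ∧ v 1 < R.mark 1 + c := (hv 1).1
  have hv2 : R.mark 2 - c < v 2 ∧ v 2 < R.mark 2 := (hv 2).1
  have hv3 : R.mark 3 < v 3 ∧ v 3 < R.mark 3 + c := (hv 3).1
  have huM : StrictMono u := Fin.strictMono_iff_lt_succ.2 fun k => by
    fin_cases k
    · show u 0 < u 1; linarith
    · show u 1 < u 2; linarith
    · show u 2 < u 3; linarith
  have hvM : StrictMono v := Fin.strictMono_iff_lt_succ.2 fun k => by
    fin_cases k
    · show v 0 < v 1; linarith
    · show v 1 < v 2; linarith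
    · show v 2 < v 3; linarith
  have huI : ∀ i, u i ∈ Icc S₀ S := fun i => by
    fin_cases i
    · show u 0 ∈ Icc S₀ S; exact ⟨by linarith, by linarith⟩
    · show u 1 ∈ Icc S₀ S; exact ⟨by linarith, by linarith⟩
    · show u 2 ∈ Icc S₀ S; exact ⟨by linarith, by linarith⟩
    · show u 3 ∈ Icc S₀ S; exact ⟨by linarith, by linarith⟩
  have hvI : ∀ i, v i ∈ Icc S₀ S := fun i => by
    fin_cases i
    · show v 0 ∈ Icc S₀ S; exact ⟨by linarith, by linarith⟩
    · show v 1 ∈ Icc S₀ S; exact ⟨by linarith, by linarith⟩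
    · show v 2 ∈ Icc S₀ S; exact ⟨by linarith, by linarith⟩
    · show v 3 ∈ Icc S₀ S; exact ⟨by linarith, by linarith⟩
  have hud : ∀ i, dist (u i) (R.mark i) < η := fun i => by
    rw [Real.dist_eq, abs_sub_lt_iff]
    fin_cases i
    · show u 0 - R.mark 0 < η ∧ R.mark 0 - u 0 < η; constructor <;> linarith
    · show u 1 - R.mark 1 < η ∧ R.mark 1 - u 1 < η; constructor <;> linarith
    · show u 2 - R.mark 2 < η ∧ R.mark 2 - u 2 < η; constructor <;> linarith
    · show u 3 - R.mark 3 < η ∧ R.mark 3 - u 3 < η; constructor <;> linarith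
  have hvd : ∀ i, dist (v i) (R.mark i) < η := fun i => by
    rw [Real.dist_eq, abs_sub_lt_iff]
    fin_cases i
    · show v 0 - R.mark 0 < η ∧ R.mark 0 - v 0 < η; constructor <;> linarith
    · show v 1 - R.mark 1 < η ∧ R.mark 1 - v 1 < η; constructor <;> linarith
    · show v 2 - R.mark 2 < η ∧ R.mark 2 - v 2 < η; constructor <;> linarith
    · show v 3 - R.mark 3 < η ∧ R.mark 3 - v 3 < η; constructor <;> linarith
  -- (3)+(5) Cardy for the re-marked flat rectangles `R_in = R♯(u)`, `R_out = R♯(v)`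
  have hlim_in := tendsto_crossingProb_of_flatParams hflat R hR huM (huI 0).1
    (by linarith [(huI 3).2]) (fun i => hT _ (huI i) (hu i).2) φ
    (strictMono_or_strictAnti_comp hgm huM huI) fun i => hbv _ (huI i)
  have hlim_out := tendsto_crossingProb_of_flatParams hflat R hR hvM (hvI 0).1
    (by linarith [(hvI 3).2]) (fun i => hT _ (hvI i) (hv i).2) φ
    (strictMono_or_strictAnti_comp hgm hvM hvI) fun i => hbv _ (hvI i)
  -- (6b) their limits are within `ε / 2` of the predicted limit of `R`
  have hdu := hcont u huI hud
  have hdv := hcont v hvI hvd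
  -- (4) monotonicity: `P(R_in) ≤ P(R) ≤ P(R_out)` at every mesh
  have hfr : ∀ t, R.boundary t ∈ frontier R.carrier := R.boundary_mem_frontier
  have hmono_in : ∀ δ, discreteCrossingProb half R.carrier δ (R.boundary '' Icc (u 0) (u 1))
      (R.boundary '' Icc (u 2) (u 3)) ≤ bondDomainCrossingProb R δ := fun δ => by
    show _ ≤ discreteCrossingProb half R.carrier δ (R.arc 0) (R.arc 2)
    rw [harc0, harc2]
    refine discreteCrossingProb_mono (image_mono (Icc_subset_Icc hu0.1.le hu1.2.le))
      ((nonempty_Icc.2 (by linarith)).image _)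
      ⟨R.boundary (R.mark 2), hfr _, boundary_notMem_image_Icc R hSS₀ (hmI 0).1 (hmI 1).2 (hmI 2)
        fun h => by linarith [h.2]⟩
      (image_mono (Icc_subset_Icc hu2.1.le hu3.2.le)) ((nonempty_Icc.2 (by linarith)).image _)
      ⟨R.boundary (R.mark 0), hfr _, boundary_notMem_image_Icc R hSS₀ (hmI 2).1 (hmI 3).2 (hmI 0)
        fun h => by linarith [h.1]⟩
  have hmono_out : ∀ δ, bondDomainCrossingProb R δ ≤ discreteCrossingProb half R.carrier δ
      (R.boundary '' Icc (v 0) (v 1)) (R.boundary '' Icc (v 2) (v 3)) := fun δ => by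
    show discreteCrossingProb half R.carrier δ (R.arc 0) (R.arc 2) ≤ _
    rw [harc0, harc2]
    refine discreteCrossingProb_mono (image_mono (Icc_subset_Icc hv0.2.le hv1.1.le))
      ((nonempty_Icc.2 h01.le).image _)
      ⟨R.boundary (R.mark 2), hfr _, boundary_notMem_image_Icc R hSS₀ (hvI 0).1 (hvI 1).2 (hmI 2)
        fun h => by linarith [h.2]⟩
      (image_mono (Icc_subset_Icc hv2.2.le hv3.1.le)) ((nonempty_Icc.2 h23.le).image _)
      ⟨R.boundary (R.mark 0), hfr _, boundary_notMem_image_Icc R hSS₀ (hvI 2).1 (hvI 3).2 (hmI 0)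
        fun h => by linarith [h.1]⟩
  -- (6c) the squeeze
  filter_upwards [Metric.tendsto_nhds.1 hlim_in (ε / 2) (half_pos hε),
    Metric.tendsto_nhds.1 hlim_out (ε / 2) (half_pos hε)] with δ h1 h2
  rw [Real.dist_eq, abs_sub_lt_iff] at h1 h2 hdu hdv ⊢
  constructor <;> linarith [hmono_in δ, hmono_out δ, h1.1, h1.2, h2.1, h2.2, hdu.1, hdu.2, hdv.1, hdv.2]

end Summit.CriticalPhenomena.CardyFormulaZ2.Cruxes.RectilinearCardy.ExcursionKernelCovariance

end
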